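import Summits.QuantumFields.YangMills.Theorems.UnitScaleTiltProp7SectET3OpsT3HilbertRows
import Summits.QuantumFields.YangMills.Theorems.UnitScaleTiltProp7SectET3OpsOfConjugateReading
import HarnessLib

/-!
# Route `UnitScaleTilt` (α), node N06(d = 3), layer 0 ∕ brick L0f — **THE `Ops`-RECORD ROWS `Identities 𝔬 U`, THE LETTER-SYMMETRY ROW AND `PosDefEnd (𝔬.S0 U)` FOR ANY
# LETTER RECORD THAT READS ym-inputs-p01's LAYER-0 TOTAL LETTERS (three Hessian slots) THROUGH REAL COORDINATES OF THE `L²` SPACES** — ✓ `Prop7SectET3OpsOfConjugateReading`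
# with EVERY Hilbert-level hypothesis discharged by ✓ `Prop7SectET3OpsT3HilbertRows` ∕ ✓ `…Eq3124RowsT3` ∕ ✓ `…CurvedPropagatorsT3`: what remains displayed is the class `PosOnto`
# (three slots), the slot facts `hΔ`∕`hΔs`, the coordinate equivalences with their `re ⟪·,·⟫` sums, and the sixteen READING equations (`rfl` for brick L0f's `𝔬_T3` so defined)

Cell `ym-inputs` (D-0154 (2); desk `ym-inputs-plan-1` INPUT-LIST v7 §4 row p05 = I-06 (d); desk answer 2026-08-28T09:25:14Z; p05 g1's memo `pub/ym-inputs/L0F-LOCATE-p05.md` §2 (c)(d),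
§3 (i)–(iii)), seat ym-inputs-p05 g2.  Count-neutral helper (`--supports stmt-QuantumFields-20520 --as helper`; RULING g26-№2); registry untouched; THEOREMS ONLY (0 `def`, 0 `sorry`);
NOTHING of [Balaban1985BackgroundPropagators] is asserted.

THE POINT.  Brick L0f (`def 𝔬_T3`, ym-inputs-p01 names it) reads the sixteen operator letters of Track A's `B9Thm312Whole.Ops` as `e ∘ (t⁻¹ ∘ T ∘ t).restrictScalars ℝ ∘ e⁻¹` for
ℂ-linear TRANSPORTS `tX : MX ≃ₗ[ℂ] BondL2K …`, `tZ : MZ ≃ₗ[ℂ] WL2 …`, `tW : MW ≃ₗ[ℂ] SiteL2K …` of the definer's carriers onto the `L²` spaces (`LinearEquiv.refl` for the `L²` carriers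
themselves; ym-inputs-p01's `toL2`∕`toL2B`∕`toL2S` for the ROUTE carriers `PBond → M₂(ℂ)`, his `…Pi` read-back convention) and real-coordinate equivalences `eX : MX ≃ₗ[ℝ] (X → ℝ)`, `eZ`, `eW`
whose component sums are `re ⟪tX ·, tX ·⟫_ℂ` (design point (J1): √weight-scaled real and imaginary parts, ✓ `Prop7SectET3RealCoordSums`), `T` running through the dictionary `G0 := GT Δ0x`, `S0 := laplaceA Δ0x`, `Tpi := Δ0x − Δπx`, `T2 := Δπx − Δ1x`, `G := GT Δπx`, `C := KinvT Δπx`, `Hm := HT Δπx`,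
`G1 := GT Δ1x`, `C1 := KinvT Δ1x`, `H1m := HT Δ1x`, `GG := frakGT Δ1x`, `Q := Qk`, `Qstar := Qk†`, `Dv := DL2`, `Dvstar := DstarL2`, `R := RS`.  THIS FILE is the penultimate step of
`…SectET3OpsT3Rows.lean`: for ANY `𝔬` and `U` with those sixteen reading equations (hypotheses `rG0 … rR`), ★★★ `identities_of_hilbertReading` gives `Identities 𝔬 U` on the class,
★★ `letterSymm_of_hilbertReading` the row `hls` of ✓ `normG_row_of_evaluationRowsS` ∕ `normH₁_row_of_evaluationRowsS` (the `(D, D*)` member kept abstract: its Hilbert carrier is L0f's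
choice), ★ `posDefEnd_S0_of_hilbertReading` the `FormSmall.posS0` pin — so the rows file proper is these three applied to `rfl`s.
The carriers `MX MZ MW` need `Module ℝ` + `IsScalarTower ℝ ℂ` (automatic for the route carriers; for the `L²` synonyms they are §1's `isScalarTower_bondL2K`∕`_siteL2K`∕`_blockL2`,
Prop-valued — supply them with `haveI`, Mathlib does not synthesise the tower through lit-balaban's `WL2`).
HONEST SCOPE: bookkeeping (`restrictScalars` commutes with composition, F7 applied to FILE A); positivity ∕ onto-ness (the class `PosOnto`, [B9] Thm 3.11, an N06 INPUT) NOT proved;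
`hΔ`∕`hΔs` for `DeltaPiSlot`∕`Δ₁` are p01's rows; the analytic rows (`Thm33G0`, steps, letters, `FormSmall.small`) are N06 and NOT here; no summit∕sub-problem claim; rung R3, not Clay.

References: T. Bałaban, CMP **99** (1985) 389–434 [Balaban1985BackgroundPropagators] (p.391; (3.26)–(3.27) p.395; (3.120)–(3.130) pp.419–421; (3.124) p.420; (3.147) p.425;
(3.153) p.426; Thm 3.11 p.416); CMP **102** (1985) 277–309 [Balaban1985Variational] ((110)–(111) p.294).
-/

set_option autoImplicit false

noncomputable section

open scoped InnerProductSpace ComplexConjugate Matrix.Norms.L2Operator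

namespace Summit.QuantumFields.YangMills.Theorems.Prop7SectET3OpsT3ReadingRows

open Literature.MathematicalPhysics.QuantumFieldTheory.Balaban1983to89
open Literature.MathematicalPhysics.QuantumFieldTheory.Balaban1983to89.T3ContinuumYM3Torus
open Literature.MathematicalPhysics.QuantumFieldTheory.Balaban1983to89.B9Thm37Glue (IsTransposePair)
open Literature.MathematicalPhysics.QuantumFieldTheory.Balaban1983to89.B9Thm312Whole (Ops PosDefEnd Identities)
open B9Eq311L2Pairing (WL2)
open B11Eq103H1Complex (SiteL2K BondL2K)
open Summit.QuantumFields.YangMills.Theorems.Prop7SectET3Transport (periodsT3)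
open Summit.QuantumFields.YangMills.Theorems.Prop7SectET3HilbertLetters (W₂ QL2 DL2 DstarL2)
open Summit.QuantumFields.YangMills.Theorems.Prop7SectET3GaugeProjector (RS NS)
open B11Eq111FrakG (frakGLin frakGLin_apply)
open Summit.QuantumFields.YangMills.Theorems.Prop7SectET3CurvedPropagators (Qk laplaceA PosOnto GT KinvT HT frakGT HT_eq_comp)
open Summit.QuantumFields.YangMills.Theorems.Prop7SectET3OpsT3HilbertRows (GT_comp_laplaceA invG_row invG1_row c1_inv_row frakGT_eq h124Q_row hR_row h124R_row laplaceA_isSymmetric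
  sub_slot_isSymmetric inner_Qk_left inner_DL2_left inner_RS_left)
open Summit.QuantumFields.YangMills.Theorems.Prop7SectET3OpsOfConjugateReading (identities_of_conjugateReading letterSymm_of_conjugateReading posDefEnd_S0_of_conjugateReading)

variable {F : T3Family} {n K : ℕ} {h : n ≤ K} {c₀ cB a : ℝ} [Fact (0 < c₀)] [Fact (0 < cB)]
  {Δ0x Δπx Δ1x : GaugeField (F.P K) 0 (Matrix.specialUnitaryGroup (Fin 2) ℂ) → (BondL2K ℂ 3 (periodsT3 F K) c₀ W₂ →ₗ[ℂ] BondL2K ℂ 3 (periodsT3 F K) c₀ W₂)}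
  {g : B9.Geometry} {B : B9.Backgrounds} {X Y Z W : Type} [Fintype X] [Fintype Y] [Fintype Z] [Fintype W]
  {MX MZ MW : Type} [AddCommGroup MX] [Module ℂ MX] [Module ℝ MX] [IsScalarTower ℝ ℂ MX] [AddCommGroup MZ] [Module ℂ MZ] [Module ℝ MZ] [IsScalarTower ℝ ℂ MZ]
  [AddCommGroup MW] [Module ℂ MW] [Module ℝ MW] [IsScalarTower ℝ ℂ MW]

/-! ## §1 The real structure of the three `L²` carriers and `restrictScalars ℝ` bookkeeping -/

omit [Fact (0 < c₀)] in
/-- **THE FINE VECTOR FIELDS `L²` SPACE IS AN `ℝ ⊆ ℂ` SCALAR TOWER** (lit-balaban's synonym `WL2` carries the pointwise `Module ℝ`; the tower is `Pi.isScalarTower` read through the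
synonym) — supply it with `haveI` before reading the letters with `restrictScalars ℝ`. [folklore] -/
theorem isScalarTower_bondL2K : IsScalarTower ℝ ℂ (BondL2K ℂ 3 (periodsT3 F K) c₀ W₂) := Pi.isScalarTower

omit [Fact (0 < c₀)] in
/-- The gauge-parameter `L²` space is an `ℝ ⊆ ℂ` scalar tower. [folklore] -/
theorem isScalarTower_siteL2K : IsScalarTower ℝ ℂ (SiteL2K ℂ 3 (periodsT3 F K) c₀ W₂) := Pi.isScalarTower

omit [Fact (0 < c₀)] [Fact (0 < cB)] in
/-- The block-field `L²` space is an `ℝ ⊆ ℂ` scalar tower. [folklore] -/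
theorem isScalarTower_blockL2 : IsScalarTower ℝ ℂ (WL2 ℂ (fun _ : PBond (F.P n) 0 => cB) W₂) := Pi.isScalarTower

section RS

variable {M₁ M₂ M₃ : Type} [AddCommGroup M₁] [Module ℂ M₁] [AddCommGroup M₂] [Module ℂ M₂] [AddCommGroup M₃] [Module ℂ M₃]
  [Module ℝ M₁] [Module ℝ M₂] [Module ℝ M₃] [LinearMap.CompatibleSMul M₁ M₂ ℝ ℂ] [LinearMap.CompatibleSMul M₂ M₃ ℝ ℂ] [LinearMap.CompatibleSMul M₁ M₃ ℝ ℂ]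

/-- `(A ∘ B)|_ℝ = A|_ℝ ∘ B|_ℝ`. [folklore] -/
theorem restrictScalars_comp' (A : M₂ →ₗ[ℂ] M₃) (B' : M₁ →ₗ[ℂ] M₂) : (A ∘ₗ B').restrictScalars ℝ = A.restrictScalars ℝ ∘ₗ B'.restrictScalars ℝ := rfl

/-- `id|_ℝ = id`. [folklore] -/
theorem restrictScalars_id' [LinearMap.CompatibleSMul M₁ M₁ ℝ ℂ] : (LinearMap.id : M₁ →ₗ[ℂ] M₁).restrictScalars ℝ = LinearMap.id := rfl

/-- `(A − B)|_ℝ = A|_ℝ − B|_ℝ`. [folklore] -/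
theorem restrictScalars_sub' (A B' : M₁ →ₗ[ℂ] M₂) : (A - B').restrictScalars ℝ = A.restrictScalars ℝ - B'.restrictScalars ℝ := rfl

/-- `(A + B)|_ℝ = A|_ℝ + B|_ℝ`. [folklore] -/
theorem restrictScalars_add' (A B' : M₁ →ₗ[ℂ] M₂) : (A + B').restrictScalars ℝ = A.restrictScalars ℝ + B'.restrictScalars ℝ := rfl

/-- `0|_ℝ = 0`. [folklore] -/
theorem restrictScalars_zero' : (0 : M₁ →ₗ[ℂ] M₂).restrictScalars ℝ = 0 := rfl

end RS

section Transport

variable {M₁ M₂ M₃ E₁ E₂ E₃ : Type} [AddCommGroup M₁] [Module ℂ M₁] [AddCommGroup M₂] [Module ℂ M₂] [AddCommGroup M₃] [Module ℂ M₃]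
  [AddCommGroup E₁] [Module ℂ E₁] [AddCommGroup E₂] [Module ℂ E₂] [AddCommGroup E₃] [Module ℂ E₃]

/-- Transported letters compose: `(t₃⁻¹ A t₂) ∘ (t₂⁻¹ B t₁) = t₃⁻¹ (A ∘ B) t₁`. [folklore] -/
theorem transport_comp_transport (t₁ : M₁ ≃ₗ[ℂ] E₁) (t₂ : M₂ ≃ₗ[ℂ] E₂) (t₃ : M₃ ≃ₗ[ℂ] E₃) (A : E₂ →ₗ[ℂ] E₃) (B' : E₁ →ₗ[ℂ] E₂) :
    (t₃.symm.toLinearMap ∘ₗ A ∘ₗ t₂.toLinearMap) ∘ₗ (t₂.symm.toLinearMap ∘ₗ B' ∘ₗ t₁.toLinearMap) = t₃.symm.toLinearMap ∘ₗ (A ∘ₗ B') ∘ₗ t₁.toLinearMap := by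
  apply LinearMap.ext
  intro x
  simp only [LinearMap.coe_comp, LinearEquiv.coe_coe, Function.comp_apply, LinearEquiv.apply_symm_apply]

/-- The transport of the identity is the identity. [folklore] -/
theorem transport_id (t : M₁ ≃ₗ[ℂ] E₁) : t.symm.toLinearMap ∘ₗ (LinearMap.id : E₁ →ₗ[ℂ] E₁) ∘ₗ t.toLinearMap = LinearMap.id := by
  apply LinearMap.ext
  intro x
  simp only [LinearMap.coe_comp, LinearEquiv.coe_coe, Function.comp_apply, LinearMap.id_coe, id_eq, LinearEquiv.symm_apply_apply]

/-- The transport of `0` is `0`. [folklore] -/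
theorem transport_zero (t₁ : M₁ ≃ₗ[ℂ] E₁) (t₂ : M₂ ≃ₗ[ℂ] E₂) : t₂.symm.toLinearMap ∘ₗ (0 : E₁ →ₗ[ℂ] E₂) ∘ₗ t₁.toLinearMap = 0 := by
  rw [LinearMap.zero_comp, LinearMap.comp_zero]

/-- Transport respects differences. [folklore] -/
theorem transport_sub (t₁ : M₁ ≃ₗ[ℂ] E₁) (t₂ : M₂ ≃ₗ[ℂ] E₂) (A B' : E₁ →ₗ[ℂ] E₂) :
    t₂.symm.toLinearMap ∘ₗ (A - B') ∘ₗ t₁.toLinearMap = t₂.symm.toLinearMap ∘ₗ A ∘ₗ t₁.toLinearMap - t₂.symm.toLinearMap ∘ₗ B' ∘ₗ t₁.toLinearMap := by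
  rw [LinearMap.sub_comp, LinearMap.comp_sub]

/-- Transport respects sums. [folklore] -/
theorem transport_add (t₁ : M₁ ≃ₗ[ℂ] E₁) (t₂ : M₂ ≃ₗ[ℂ] E₂) (A B' : E₁ →ₗ[ℂ] E₂) :
    t₂.symm.toLinearMap ∘ₗ (A + B') ∘ₗ t₁.toLinearMap = t₂.symm.toLinearMap ∘ₗ A ∘ₗ t₁.toLinearMap + t₂.symm.toLinearMap ∘ₗ B' ∘ₗ t₁.toLinearMap := by
  rw [LinearMap.add_comp, LinearMap.comp_add]

end Transport

/-! ## §2 `Identities 𝔬 U` for a letter record reading the layer-0 letters -/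

omit [Fintype Y] in
/-- ★★★ **`Identities 𝔬 U` FOR ANY LETTER RECORD READING THE LAYER-0 TOTAL LETTERS THROUGH TRANSPORTS AND REAL COORDINATES**, on the class `PosOnto` of the three slots and given
the slot facts `hΔ1` (the `Δ₁`-slot kills `D_{U₀}N_S`) and `hΔs1` (it is symmetric): all thirteen fields — `invG0'`∕`invG`∕`invG1` (✓`GT_comp_laplaceA`, ✓`invG_row`, ✓`invG1_row`),
`eq126`∕`eq129` (✓`HT_eq_comp`), `eq153` (lit-balaban's `frakGLin_apply`), `c1_inv` (✓`c1_inv_row`), `h124Q`∕`h124R`∕`hR` (✓`h124Q_row`∕`h124R_row`∕`hR_row`, the (3.124) triple),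
`adjQ`∕`adjDv`∕`symmR` (✓`inner_Qk_left`∕`inner_DL2_left`∕`inner_RS_left`) — via ✓`identities_of_conjugateReading`.  Carriers: `MX MZ MW` with ℂ-linear transports `tX tZ tW` onto the
`L²` spaces (`LinearEquiv.refl _ _` for the `L²` carriers, `toL2`∕`toL2B`∕`toL2S` for the route carriers). [cite: Balaban1985BackgroundPropagators, (3.120)–(3.130) pp.419–421, (3.124) p.420, (3.147) p.425, (3.152)–(3.153) p.426, p.391] -/
theorem identities_of_hilbertReading (𝔬 : Ops g B X Y Z W) (U : B.Cfg) {U₀ : GaugeField (F.P K) 0 (Matrix.specialUnitaryGroup (Fin 2) ℂ)}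
    (hp0 : PosOnto F n K h c₀ cB a Δ0x U₀) (hpπ : PosOnto F n K h c₀ cB a Δπx U₀) (hp1 : PosOnto F n K h c₀ cB a Δ1x U₀)
    (hΔ1 : ∀ l ∈ NS F n K h c₀ cB U₀, Δ1x U₀ (DL2 F n K c₀ U₀ l) = 0) (hΔs1 : (Δ1x U₀).IsSymmetric)
    (tX : MX ≃ₗ[ℂ] BondL2K ℂ 3 (periodsT3 F K) c₀ W₂) (tZ : MZ ≃ₗ[ℂ] WL2 ℂ (fun _ : PBond (F.P n) 0 => cB) W₂) (tW : MW ≃ₗ[ℂ] SiteL2K ℂ 3 (periodsT3 F K) c₀ W₂)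
    (eX : MX ≃ₗ[ℝ] (X → ℝ)) (eZ : MZ ≃ₗ[ℝ] (Z → ℝ)) (eW : MW ≃ₗ[ℝ] (W → ℝ))
    (hPX : ∀ u v, ∑ x, eX u x * eX v x = (⟪tX u, tX v⟫_ℂ).re) (hPZ : ∀ u v, ∑ z, eZ u z * eZ v z = (⟪tZ u, tZ v⟫_ℂ).re) (hPW : ∀ u v, ∑ w, eW u w * eW v w = (⟪tW u, tW v⟫_ℂ).re)
    -- ======== the sixteen reading equations (`rfl` for brick L0f's `𝔬_T3`) ========
    (rG0 : 𝔬.G0 U = eX.toLinearMap ∘ₗ (tX.symm.toLinearMap ∘ₗ GT F n K h c₀ cB a Δ0x U₀ ∘ₗ tX.toLinearMap).restrictScalars ℝ ∘ₗ eX.symm.toLinearMap)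
    (rS0 : 𝔬.S0 U = eX.toLinearMap ∘ₗ (tX.symm.toLinearMap ∘ₗ laplaceA F n K h c₀ cB a Δ0x U₀ ∘ₗ tX.toLinearMap).restrictScalars ℝ ∘ₗ eX.symm.toLinearMap)
    (rTpi : 𝔬.Tpi U = eX.toLinearMap ∘ₗ (tX.symm.toLinearMap ∘ₗ (Δ0x U₀ - Δπx U₀) ∘ₗ tX.toLinearMap).restrictScalars ℝ ∘ₗ eX.symm.toLinearMap)
    (rT2 : 𝔬.T2 U = eX.toLinearMap ∘ₗ (tX.symm.toLinearMap ∘ₗ (Δπx U₀ - Δ1x U₀) ∘ₗ tX.toLinearMap).restrictScalars ℝ ∘ₗ eX.symm.toLinearMap)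
    (rG : 𝔬.G U = eX.toLinearMap ∘ₗ (tX.symm.toLinearMap ∘ₗ GT F n K h c₀ cB a Δπx U₀ ∘ₗ tX.toLinearMap).restrictScalars ℝ ∘ₗ eX.symm.toLinearMap)
    (rG1 : 𝔬.G1 U = eX.toLinearMap ∘ₗ (tX.symm.toLinearMap ∘ₗ GT F n K h c₀ cB a Δ1x U₀ ∘ₗ tX.toLinearMap).restrictScalars ℝ ∘ₗ eX.symm.toLinearMap)
    (rGG : 𝔬.GG U = eX.toLinearMap ∘ₗ (tX.symm.toLinearMap ∘ₗ frakGT F n K h c₀ cB a Δ1x U₀ ∘ₗ tX.toLinearMap).restrictScalars ℝ ∘ₗ eX.symm.toLinearMap)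
    (rQ : 𝔬.Q U = eZ.toLinearMap ∘ₗ (tZ.symm.toLinearMap ∘ₗ Qk F n K h c₀ cB U₀ ∘ₗ tX.toLinearMap).restrictScalars ℝ ∘ₗ eX.symm.toLinearMap)
    (rQstar : 𝔬.Qstar U = eX.toLinearMap ∘ₗ (tX.symm.toLinearMap ∘ₗ LinearMap.adjoint (Qk F n K h c₀ cB U₀) ∘ₗ tZ.toLinearMap).restrictScalars ℝ ∘ₗ eZ.symm.toLinearMap)
    (rC : 𝔬.C U = eZ.toLinearMap ∘ₗ (tZ.symm.toLinearMap ∘ₗ KinvT F n K h c₀ cB a Δπx U₀ ∘ₗ tZ.toLinearMap).restrictScalars ℝ ∘ₗ eZ.symm.toLinearMap)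
    (rC1 : 𝔬.C1 U = eZ.toLinearMap ∘ₗ (tZ.symm.toLinearMap ∘ₗ KinvT F n K h c₀ cB a Δ1x U₀ ∘ₗ tZ.toLinearMap).restrictScalars ℝ ∘ₗ eZ.symm.toLinearMap)
    (rHm : 𝔬.Hm U = eX.toLinearMap ∘ₗ (tX.symm.toLinearMap ∘ₗ HT F n K h c₀ cB a Δπx U₀ ∘ₗ tZ.toLinearMap).restrictScalars ℝ ∘ₗ eZ.symm.toLinearMap)
    (rH1m : 𝔬.H1m U = eX.toLinearMap ∘ₗ (tX.symm.toLinearMap ∘ₗ HT F n K h c₀ cB a Δ1x U₀ ∘ₗ tZ.toLinearMap).restrictScalars ℝ ∘ₗ eZ.symm.toLinearMap)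
    (rDv : 𝔬.Dv U = eX.toLinearMap ∘ₗ (tX.symm.toLinearMap ∘ₗ DL2 F n K c₀ U₀ ∘ₗ tW.toLinearMap).restrictScalars ℝ ∘ₗ eW.symm.toLinearMap)
    (rDvstar : 𝔬.Dvstar U = eW.toLinearMap ∘ₗ (tW.symm.toLinearMap ∘ₗ DstarL2 F n K c₀ U₀ ∘ₗ tX.toLinearMap).restrictScalars ℝ ∘ₗ eX.symm.toLinearMap)
    (rR : 𝔬.R U = eW.toLinearMap ∘ₗ (tW.symm.toLinearMap ∘ₗ RS F n K h c₀ cB U₀ ∘ₗ tW.toLinearMap).restrictScalars ℝ ∘ₗ eW.symm.toLinearMap) :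
    Identities 𝔬 U := by
  refine identities_of_conjugateReading 𝔬 U eX eZ eW (fun u v => (⟪tX u, tX v⟫_ℂ).re) (fun u v => (⟪tZ u, tZ v⟫_ℂ).re) (fun u v => (⟪tW u, tW v⟫_ℂ).re) hPX hPZ hPW
    _ _ _ _ _ _ _ _ _ _ _ _ _ _ _ _ rG0 rS0 rTpi rT2 rG rG1 rGG rQ rQstar rC rC1 rHm rH1m rDv rDvstar rR ?_ ?_ ?_ ?_ ?_ ?_ ?_ ?_ ?_ ?_ ?_ ?_ ?_
  · -- invG0' : G₀ Δ_a = 1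
    rw [← restrictScalars_comp', transport_comp_transport, GT_comp_laplaceA hp0, transport_id, restrictScalars_id']
  · -- invG : (Δ_a − Δ′_π) G = 1
    rw [← restrictScalars_sub', ← transport_sub, ← restrictScalars_comp', transport_comp_transport, invG_row hpπ, transport_id, restrictScalars_id']
  · -- invG1 : (Δ_a − (Δ′_π + Δ⁽²⁾_π)) G₁ = 1
    rw [← restrictScalars_add', ← transport_add, ← restrictScalars_sub', ← transport_sub, ← restrictScalars_comp', transport_comp_transport, invG1_row hp1, transport_id,
      restrictScalars_id']
  · -- eq126
    rw [← restrictScalars_comp', ← restrictScalars_comp', transport_comp_transport, transport_comp_transport, ← HT_eq_comp hpπ]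
  · -- eq129
    rw [← restrictScalars_comp', ← restrictScalars_comp', transport_comp_transport, transport_comp_transport, ← HT_eq_comp hp1]
  · -- eq153 (pointwise: `frakGLin_apply` on both sides)
    apply LinearMap.ext
    intro f
    simp only [frakGT, LinearMap.coe_comp, LinearMap.coe_restrictScalars, Function.comp_apply, LinearEquiv.coe_coe, LinearMap.sub_apply, LinearMap.id_coe, id_eq,
      LinearEquiv.apply_symm_apply, map_sub, frakGLin_apply]
  · -- c1_inv
    rw [← restrictScalars_comp', ← restrictScalars_comp', ← restrictScalars_comp', transport_comp_transport, transport_comp_transport, transport_comp_transport,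
      c1_inv_row hp1, transport_id, restrictScalars_id']
  · -- h124Q
    rw [← restrictScalars_comp', ← restrictScalars_comp', ← restrictScalars_comp', transport_comp_transport, transport_comp_transport, transport_comp_transport,
      h124Q_row hp1 hΔ1, transport_zero, restrictScalars_zero']
  · -- h124R
    rw [← restrictScalars_comp', ← restrictScalars_comp', ← restrictScalars_comp', transport_comp_transport, transport_comp_transport, transport_comp_transport,
      h124R_row hp1 hΔs1 hΔ1, transport_zero, restrictScalars_zero']
  · -- hR
    rw [← restrictScalars_comp', ← restrictScalars_comp', ← restrictScalars_comp', ← restrictScalars_comp', transport_comp_transport, transport_comp_transport,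
      transport_comp_transport, transport_comp_transport, hR_row hp1 hΔ1]
  · -- adjQ
    intro u b
    simp only [LinearMap.coe_comp, LinearMap.coe_restrictScalars, Function.comp_apply, LinearEquiv.coe_coe, LinearEquiv.apply_symm_apply, inner_Qk_left]
  · -- adjDv
    intro s f
    simp only [LinearMap.coe_comp, LinearMap.coe_restrictScalars, Function.comp_apply, LinearEquiv.coe_coe, LinearEquiv.apply_symm_apply, inner_DL2_left]
  · -- symmR
    intro s t
    simp only [LinearMap.coe_comp, LinearMap.coe_restrictScalars, Function.comp_apply, LinearEquiv.coe_coe, LinearEquiv.apply_symm_apply, inner_RS_left]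

/-! ## §3 The letter-symmetry row `hls` and the positivity pin -/

omit [Fintype Z] [Fintype W] in
/-- ★★ **THE LETTER-SYMMETRY ROW** (`hls` of ✓`normG_row_of_evaluationRowsS`) for a letter record reading the layer-0 letters: `S0`, `Tpi`, `T2` symmetric from the slot symmetries
(✓`laplaceA_isSymmetric`, ✓`sub_slot_isSymmetric`), and `(D, Dstar)` a transpose pair from ANY pair `(d, dstar)` it reads that is adjoint for the pairings (the Hilbert carrier of `∇_U A`
is brick L0f's choice — kept abstract). [cite: Balaban1985BackgroundPropagators, p.391, (3.26) p.395, (3.120) p.419, (3.134) p.422] -/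
theorem letterSymm_of_hilbertReading (𝔬 : Ops g B X Y Z W) (U : B.Cfg) {U₀ : GaugeField (F.P K) 0 (Matrix.specialUnitaryGroup (Fin 2) ℂ)}
    (hΔs0 : (Δ0x U₀).IsSymmetric) (hΔsπ : (Δπx U₀).IsSymmetric) (hΔs1 : (Δ1x U₀).IsSymmetric)
    {MY : Type} [AddCommGroup MY] [Module ℝ MY]
    (tX : MX ≃ₗ[ℂ] BondL2K ℂ 3 (periodsT3 F K) c₀ W₂) (eX : MX ≃ₗ[ℝ] (X → ℝ)) (eY : MY ≃ₗ[ℝ] (Y → ℝ)) (PY : MY → MY → ℝ)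
    (hPX : ∀ u v, ∑ x, eX u x * eX v x = (⟪tX u, tX v⟫_ℂ).re) (hPY : ∀ u v, ∑ y, eY u y * eY v y = PY u v)
    (d : MX →ₗ[ℝ] MY) (dstar : MY →ₗ[ℝ] MX)
    (rS0 : 𝔬.S0 U = eX.toLinearMap ∘ₗ (tX.symm.toLinearMap ∘ₗ laplaceA F n K h c₀ cB a Δ0x U₀ ∘ₗ tX.toLinearMap).restrictScalars ℝ ∘ₗ eX.symm.toLinearMap)
    (rTpi : 𝔬.Tpi U = eX.toLinearMap ∘ₗ (tX.symm.toLinearMap ∘ₗ (Δ0x U₀ - Δπx U₀) ∘ₗ tX.toLinearMap).restrictScalars ℝ ∘ₗ eX.symm.toLinearMap)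
    (rT2 : 𝔬.T2 U = eX.toLinearMap ∘ₗ (tX.symm.toLinearMap ∘ₗ (Δπx U₀ - Δ1x U₀) ∘ₗ tX.toLinearMap).restrictScalars ℝ ∘ₗ eX.symm.toLinearMap)
    (rD : 𝔬.D U = eY.toLinearMap ∘ₗ d ∘ₗ eX.symm.toLinearMap) (rDstar : 𝔬.Dstar U = eX.toLinearMap ∘ₗ dstar ∘ₗ eY.symm.toLinearMap)
    (hd : ∀ (u : MX) (w : MY), PY (d u) w = (⟪tX u, tX (dstar w)⟫_ℂ).re) :
    IsTransposePair (𝔬.S0 U) (𝔬.S0 U) ∧ IsTransposePair (𝔬.Tpi U) (𝔬.Tpi U) ∧ IsTransposePair (𝔬.T2 U) (𝔬.T2 U) ∧ IsTransposePair (𝔬.D U) (𝔬.Dstar U) := by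
  refine letterSymm_of_conjugateReading 𝔬 U eX eY (fun u v => (⟪tX u, tX v⟫_ℂ).re) PY hPX hPY _ _ _ d dstar rS0 rTpi rT2 rD rDstar ?_ ?_ ?_ hd
  · intro u v
    simp only [LinearMap.coe_comp, LinearMap.coe_restrictScalars, Function.comp_apply, LinearEquiv.coe_coe, LinearEquiv.apply_symm_apply,
      laplaceA_isSymmetric (h := h) (cB := cB) (a := a) hΔs0 _ _]
  · intro u v
    simp only [LinearMap.coe_comp, LinearMap.coe_restrictScalars, Function.comp_apply, LinearEquiv.coe_coe, LinearEquiv.apply_symm_apply, sub_slot_isSymmetric hΔs0 hΔsπ _ _]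
  · intro u v
    simp only [LinearMap.coe_comp, LinearMap.coe_restrictScalars, Function.comp_apply, LinearEquiv.coe_coe, LinearEquiv.apply_symm_apply, sub_slot_isSymmetric hΔsπ hΔs1 _ _]

omit [Fintype Y] [Fintype Z] [Fintype W] in
/-- ★ **THE POSITIVITY PIN `PosDefEnd (𝔬.S0 U)`** (`FormSmall.posS0`, Theorem 3.11's meaning) for a letter record reading `Δ_a[Δ0x]`: it IS the class field `PosOnto.pos` (read through the
transport). [cite: Balaban1985BackgroundPropagators, Thm 3.11 p.416] -/
theorem posDefEnd_S0_of_hilbertReading (𝔬 : Ops g B X Y Z W) (U : B.Cfg) {U₀ : GaugeField (F.P K) 0 (Matrix.specialUnitaryGroup (Fin 2) ℂ)} (hp0 : PosOnto F n K h c₀ cB a Δ0x U₀)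
    (tX : MX ≃ₗ[ℂ] BondL2K ℂ 3 (periodsT3 F K) c₀ W₂) (eX : MX ≃ₗ[ℝ] (X → ℝ)) (hPX : ∀ u v, ∑ x, eX u x * eX v x = (⟪tX u, tX v⟫_ℂ).re)
    (rS0 : 𝔬.S0 U = eX.toLinearMap ∘ₗ (tX.symm.toLinearMap ∘ₗ laplaceA F n K h c₀ cB a Δ0x U₀ ∘ₗ tX.toLinearMap).restrictScalars ℝ ∘ₗ eX.symm.toLinearMap) :
    PosDefEnd (𝔬.S0 U) :=
  posDefEnd_S0_of_conjugateReading 𝔬 U eX (fun u v => (⟪tX u, tX v⟫_ℂ).re) hPX _ rS0 fun u hu => by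
    have htu : tX u ≠ 0 := fun h0 => hu (tX.injective (by rw [h0, map_zero]))
    simpa only [LinearMap.coe_comp, LinearMap.coe_restrictScalars, Function.comp_apply, LinearEquiv.coe_coe, LinearEquiv.apply_symm_apply, RCLike.re_to_complex] using
      hp0.pos (tX u) htu

end Summit.QuantumFields.YangMills.Theorems.Prop7SectET3OpsT3ReadingRows

end
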